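import Literature.Computability.QuantumComplexity.SU2GreedyDescent
import HarnessLib

/-!
# Commutators of small rotations in `SU(2)`: two-sided control of the chord

Topic `Literature/Computability/QuantumComplexity`; sequel of `SU2GreedyDescent.lean`, proof
infrastructure for the exact braid compiler of the Jones-hardness reduction (Aharonov–Arad 2011
§3.3). The compiler manufactures ever smaller rotations by group commutators
`c_{s+1} = [c_s, V c_s V⁻¹]`, choosing the conjugator `V` from a fixed finite net by an EXACT
criterion (smallest trace of the commutator). This file proves that the chords `r_s = ‖1 - c_s‖`
are then squared up to constants, `r_s²/2 ≤ r_{s+1} ≤ 2 r_s²`: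

* `rot45 ∈ SU(2)` (the real rotation by `π/4`, which carries the `z`-axis of the Bloch sphere to
  the `x`-axis) and the explicit torus commutator
  `‖1 - [D(θ), W D(θ) W⁻¹]‖² = 4 sin⁴ θ` (`norm_one_sub_torusComm_sq`; from the Fricke–Klein
  identity of `SU2ChordGeometry` with `tr D = 2cos θ`, `tr(D W D W⁻¹) = 2cos² θ`), hence
  `‖1 - [D(θ), W D(θ) W⁻¹]‖ ≥ (8/π²) θ² ≥ (8/π²) r²` for `0 ≤ θ ≤ π/2`;
* the universal upper bound `‖1 - [c, VcV⁻¹]‖ ≤ 2 r²` (`norm_one_sub_comm_conj_le`);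
* robustness under an approximate conjugator (`norm_one_sub_comm_conj_ge`): if `‖V - V₀‖ ≤ 1/200`
  for the ideal `V₀ = R W R⁻¹`, the commutator still has chord `≥ r²/2` (Dawson–Nielsen Lemma 1,
  `SolovayKitaev.norm_comm_sub_comm_le`, after `‖VcV⁻¹ - V₀cV₀⁻¹‖ ≤ 2 r ‖V - V₀‖`);
* `chord_comm_best` — for a `1/200`-net `Net` and the trace-minimising `V⋆ ∈ Net`, the new chord
  lies in `[r²/2, 2r²]`.

## References

* D. Aharonov, I. Arad, New J. Phys. 13 (2011) 035019, §3.3 [AharonovArad2011].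
* C. M. Dawson, M. A. Nielsen, QIC 6 (2006), §4.1 (balanced commutators of rotations about
  orthogonal axes), Lemma 1 [DawsonNielsen2006].
-/

noncomputable section

open scoped Matrix.Norms.L2Operator

namespace Literature.Computability.QuantumComplexity

open Matrix Complex

local notation "SU2" => Matrix.specialUnitaryGroup (Fin 2) ℂ
local notation "M2" => Matrix (Fin 2) (Fin 2) ℂ

/-! ### The group commutator -/

/-- The group commutator `[A, B] = A B A⁻¹ B⁻¹`. [folklore] -/
def gcomm (A B : SU2) : SU2 := A * B * A⁻¹ * B⁻¹

/-- Underlying matrix of the commutator. [folklore] -/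
theorem coe_gcomm (A B : SU2) : ((gcomm A B : SU2) : M2) = (A : M2) * (B : M2) * star (A : M2) * star (B : M2) := by
  rw [gcomm, Submonoid.coe_mul, Submonoid.coe_mul, Submonoid.coe_mul, SolovayKitaev.coe_inv, SolovayKitaev.coe_inv]

/-- Conjugation is a homomorphism through the commutator. [folklore] -/
theorem conj_gcomm (R A B : SU2) : R * gcomm A B * R⁻¹ = gcomm (R * A * R⁻¹) (R * B * R⁻¹) := by
  unfold gcomm; group

/-- **Universal upper bound**: `‖1 - [A, B]‖ ≤ 2 ‖1 - A‖ ‖1 - B‖`. [cite: DawsonNielsen2006, §4] -/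
theorem norm_one_sub_gcomm_le (A B : SU2) :
    ‖(1 : M2) - ((gcomm A B : SU2) : M2)‖ ≤ 2 * ‖(1 : M2) - (A : M2)‖ * ‖(1 : M2) - (B : M2)‖ := by
  rw [norm_sub_rev, coe_gcomm, norm_sub_rev (1 : M2) (A : M2), norm_sub_rev (1 : M2) (B : M2)]
  exact norm_comm_sub_one_le A.2.1 B.2.1

/-- The trace of a commutator in `SU(2)` (Fricke–Klein with unit determinants):
`tr[A,B] = x² + y² + z² - xyz - 2`, `x = tr A`, `y = tr B`, `z = tr(AB)`. [folklore] -/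
theorem trace_gcomm (A B : SU2) :
    ((gcomm A B : SU2) : M2).trace = (A : M2).trace ^ 2 + (B : M2).trace ^ 2 + ((A : M2) * (B : M2)).trace ^ 2 -
      (A : M2).trace * (B : M2).trace * ((A : M2) * (B : M2)).trace - 2 := by
  rw [coe_gcomm, star_coe_eq_adjugate, star_coe_eq_adjugate, trace_mul_mul_adjugate_mul_adjugate,
    (Matrix.mem_specialUnitaryGroup_iff.1 A.2).2, (Matrix.mem_specialUnitaryGroup_iff.1 B.2).2]
  ring

/-! ### The real rotation by `π/4` and the explicit torus commutator -/

/-- `rotMatrix t ∈ SU(2)`. [folklore] -/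
theorem rotMatrix_mem_specialUnitaryGroup (t : ℝ) : rotMatrix t ∈ Matrix.specialUnitaryGroup (Fin 2) ℂ := by
  rw [Matrix.mem_specialUnitaryGroup_iff]
  refine ⟨rotMatrix_mem t, ?_⟩
  unfold rotMatrix
  rw [Matrix.det_fin_two_of]
  have h := Real.cos_sq_add_sin_sq t
  have h' : (Real.cos t : ℂ) ^ 2 + (Real.sin t : ℂ) ^ 2 = 1 := by exact_mod_cast h
  linear_combination h'

/-- **`W = rot45`**, the real rotation `[[c, -s], [s, c]]`, `c = s = cos(π/4)`; on the Bloch sphere it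
takes the `z`-axis to the `x`-axis. [cite: DawsonNielsen2006, §4.1] -/
def rot45 : SU2 := ⟨rotMatrix (Real.pi / 4), rotMatrix_mem_specialUnitaryGroup _⟩

/-- `cos(π/4)² = 1/2` in `ℂ`. [folklore] -/
theorem cos_pi_div_four_mul_self : ((Real.cos (Real.pi / 4) : ℝ) : ℂ) * ((Real.cos (Real.pi / 4) : ℝ) : ℂ) = 1 / 2 := by
  rw [← Complex.ofReal_mul, Real.cos_pi_div_four]
  have h2 : Real.sqrt 2 * Real.sqrt 2 = 2 := Real.mul_self_sqrt (by norm_num)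
  have : Real.sqrt 2 / 2 * (Real.sqrt 2 / 2) = (1 / 2 : ℝ) := by linear_combination h2 / 4
  rw [this]; push_cast; ring

/-- **`tr(D W D W†) = tr(D)²/2`** for a diagonal `D` and `W = rot45`. [cite: DawsonNielsen2006, §4.1] -/
theorem trace_diag_rot45 (a b : ℂ) :
    (!![a, 0; 0, b] * (rotMatrix (Real.pi / 4) * !![a, 0; 0, b] * star (rotMatrix (Real.pi / 4)))).trace = (a + b) ^ 2 / 2 := by
  unfold rotMatrix
  rw [Real.sin_pi_div_four, ← Real.cos_pi_div_four, star_fin_two]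
  simp only [Matrix.mul_fin_two, Matrix.trace_fin_two_of, Complex.conj_ofReal, map_neg]
  linear_combination ((a + b) ^ 2) * cos_pi_div_four_mul_self

/-- `tr(D(θ) · W D(θ) W⁻¹) = 2cos²θ`. [cite: DawsonNielsen2006, §4.1] -/
theorem trace_torus_rot45_torus_rot45_inv (θ : ℝ) :
    (((torus θ : SU2) : M2) * ((rot45 * torus θ * rot45⁻¹ : SU2) : M2)).trace = ((2 * Real.cos θ ^ 2 : ℝ) : ℂ) := by
  have hx := trace_torus θ
  rw [coe_torus] at hx
  rw [Submonoid.coe_mul, Submonoid.coe_mul, SolovayKitaev.coe_inv, coe_torus]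
  change (diagMatrix θ (-θ) * (rotMatrix (Real.pi / 4) * diagMatrix θ (-θ) * star (rotMatrix (Real.pi / 4)))).trace = _
  unfold diagMatrix at hx ⊢
  rw [trace_diag_rot45]
  rw [Matrix.trace_fin_two_of] at hx
  rw [hx]
  push_cast
  ring

/-- **The explicit torus commutator**: `Re tr [D(θ), W D(θ) W⁻¹] = 2 - 4 sin⁴ θ`.
[cite: DawsonNielsen2006, §4.1] -/
theorem trace_torusComm_re (θ : ℝ) :
    (((gcomm (torus θ) (rot45 * torus θ * rot45⁻¹) : SU2) : M2).trace).re = 2 - 4 * Real.sin θ ^ 4 := by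
  rw [trace_gcomm, trace_conj, trace_torus, trace_torus_rot45_torus_rot45_inv]
  have hs := Real.sin_sq_add_cos_sq θ
  have e : (((2 * Real.cos θ : ℝ) : ℂ) ^ 2 + ((2 * Real.cos θ : ℝ) : ℂ) ^ 2 + ((2 * Real.cos θ ^ 2 : ℝ) : ℂ) ^ 2 -
      ((2 * Real.cos θ : ℝ) : ℂ) * ((2 * Real.cos θ : ℝ) : ℂ) * ((2 * Real.cos θ ^ 2 : ℝ) : ℂ) - 2 : ℂ) =
      (((8 * Real.cos θ ^ 2 - 4 * Real.cos θ ^ 4 - 2 : ℝ)) : ℂ) := by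
    push_cast; ring
  rw [e, Complex.ofReal_re]
  have hs2 : Real.sin θ ^ 2 = 1 - Real.cos θ ^ 2 := by linarith [hs]
  rw [show Real.sin θ ^ 4 = (Real.sin θ ^ 2) ^ 2 by ring, hs2]
  ring

/-- **`‖1 - [D(θ), W D(θ) W⁻¹]‖² = 4 sin⁴θ`.** [cite: DawsonNielsen2006, §4.1] -/
theorem norm_one_sub_torusComm_sq (θ : ℝ) :
    ‖(1 : M2) - ((gcomm (torus θ) (rot45 * torus θ * rot45⁻¹) : SU2) : M2)‖ ^ 2 = 4 * Real.sin θ ^ 4 := by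
  rw [norm_one_sub_coe_sq, trace_torusComm_re]; ring

/-- `‖1 - [D(θ), W D(θ) W⁻¹]‖ = 2 sin²θ`. [cite: DawsonNielsen2006, §4.1] -/
theorem norm_one_sub_torusComm (θ : ℝ) :
    ‖(1 : M2) - ((gcomm (torus θ) (rot45 * torus θ * rot45⁻¹) : SU2) : M2)‖ = 2 * Real.sin θ ^ 2 := by
  have h := norm_one_sub_torusComm_sq θ
  have hn := norm_nonneg ((1 : M2) - ((gcomm (torus θ) (rot45 * torus θ * rot45⁻¹) : SU2) : M2))
  have h2 : 0 ≤ 2 * Real.sin θ ^ 2 := by positivity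
  nlinarith [sq_nonneg (‖(1 : M2) - ((gcomm (torus θ) (rot45 * torus θ * rot45⁻¹) : SU2) : M2)‖ - 2 * Real.sin θ ^ 2),
    sq_nonneg (‖(1 : M2) - ((gcomm (torus θ) (rot45 * torus θ * rot45⁻¹) : SU2) : M2)‖ + 2 * Real.sin θ ^ 2)]

/-- **Lower bound for the ideal commutator**: for `0 ≤ θ ≤ π/2`,
`‖1 - [D(θ), W D(θ) W⁻¹]‖ ≥ (8/π²) θ²` (Jordan's inequality). [cite: DawsonNielsen2006, §4.1] -/
theorem torusComm_lower {θ : ℝ} (h0 : 0 ≤ θ) (hθ : θ ≤ Real.pi / 2) :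
    8 / Real.pi ^ 2 * θ ^ 2 ≤ ‖(1 : M2) - ((gcomm (torus θ) (rot45 * torus θ * rot45⁻¹) : SU2) : M2)‖ := by
  rw [norm_one_sub_torusComm]
  have hj := Real.mul_le_sin h0 hθ
  have hpi := Real.pi_pos
  have h1 : 0 ≤ 2 / Real.pi * θ := by positivity
  have h2 : (2 / Real.pi * θ) ^ 2 ≤ Real.sin θ ^ 2 := pow_le_pow_left₀ h1 hj 2
  have e : 8 / Real.pi ^ 2 * θ ^ 2 = 2 * (2 / Real.pi * θ) ^ 2 := by field_simp; ring
  rw [e]; linarith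

/-! ### Robustness under an approximate conjugator -/

/-- `‖1 - R X R⁻¹‖ = ‖1 - X‖`. [folklore] -/
theorem norm_one_sub_conj (R X : SU2) : ‖(1 : M2) - ((R * X * R⁻¹ : SU2) : M2)‖ = ‖(1 : M2) - (X : M2)‖ := by
  have e : (1 : M2) - ((R * X * R⁻¹ : SU2) : M2) = (R : M2) * ((1 : M2) - (X : M2)) * ((R⁻¹ : SU2) : M2) := by
    have h1 : (R : M2) * ((R⁻¹ : SU2) : M2) = 1 := by rw [← Submonoid.coe_mul, mul_inv_cancel]; rfl
    rw [Matrix.mul_sub, Matrix.sub_mul, Matrix.mul_one, h1, Submonoid.coe_mul, Submonoid.coe_mul]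
  rw [e, SolovayKitaev.norm_conj]

/-- **Nearby conjugators give nearby conjugates of a small element**:
`‖V c V⁻¹ - V₀ c V₀⁻¹‖ ≤ 2 ‖1 - c‖ ‖V - V₀‖`. [folklore] -/
theorem norm_conj_sub_conj_le (c V V₀ : SU2) :
    ‖((V * c * V⁻¹ : SU2) : M2) - ((V₀ * c * V₀⁻¹ : SU2) : M2)‖ ≤ 2 * ‖(1 : M2) - (c : M2)‖ * ‖(V : M2) - (V₀ : M2)‖ := by
  set P : SU2 := V₀⁻¹ * V with hP
  have e1 : V * c * V⁻¹ = V₀ * (P * c * P⁻¹) * V₀⁻¹ := by rw [hP]; group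
  have e2 : ‖((V * c * V⁻¹ : SU2) : M2) - ((V₀ * c * V₀⁻¹ : SU2) : M2)‖ = ‖(P : M2) * (c : M2) * ((P⁻¹ : SU2) : M2) - (c : M2)‖ := by
    rw [e1]
    simp only [Submonoid.coe_mul]
    exact norm_conj_sub_conj V₀ _ _
  -- `‖P - 1‖ = ‖V - V₀‖`
  have hPn : ‖(P : M2) - 1‖ = ‖(V : M2) - (V₀ : M2)‖ := by
    have e3 : (P : M2) - 1 = ((V₀⁻¹ : SU2) : M2) * ((V : M2) - (V₀ : M2)) := by
      rw [Matrix.mul_sub, ← Submonoid.coe_mul, ← Submonoid.coe_mul, inv_mul_cancel, ← hP]; rfl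
    rw [e3, SolovayKitaev.norm_coe_mul]
  rw [e2, norm_sub_rev, SolovayKitaev.coe_inv]
  calc ‖(c : M2) - (P : M2) * (c : M2) * star (P : M2)‖ ≤ 2 * ‖(c : M2) - 1‖ * ‖(P : M2) - 1‖ := norm_sub_conj_le P.2.1
    _ = 2 * ‖(1 : M2) - (c : M2)‖ * ‖(V : M2) - (V₀ : M2)‖ := by rw [norm_sub_rev (c : M2) 1, hPn]

/-- **Dawson–Nielsen perturbation of a commutator** (their Lemma 1, in `SU(2)` form): if
`‖1 - c‖, ‖1 - Y₀‖ ≤ r` and `‖Y - Y₀‖ ≤ δ` then `‖[c, Y] - [c, Y₀]‖ ≤ 16 r δ + 14 δ²`.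
[cite: DawsonNielsen2006, Lemma 1] -/
theorem norm_gcomm_sub_gcomm_le (c Y Y₀ : SU2) {r δ : ℝ} (hc : ‖(1 : M2) - (c : M2)‖ ≤ r)
    (hY₀ : ‖(1 : M2) - (Y₀ : M2)‖ ≤ r) (hY : ‖(Y : M2) - (Y₀ : M2)‖ ≤ δ) :
    ‖((gcomm c Y : SU2) : M2) - ((gcomm c Y₀ : SU2) : M2)‖ ≤ 16 * r * δ + 14 * δ ^ 2 := by
  have hδ : 0 ≤ δ := (norm_nonneg _).trans hY
  rw [coe_gcomm, coe_gcomm]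
  refine SolovayKitaev.norm_comm_sub_comm_le c.2.1 Y₀.2.1 c.2.1 Y.2.1 (η := r) (δ := δ) ?_ ?_ ?_ hY
  · rwa [norm_sub_rev]
  · rwa [norm_sub_rev]
  · simp [hδ]

/-- **Two-sided control of the commutator with an approximate conjugator.** Let
`c = R D(θ) R⁻¹` with `0 ≤ θ ≤ π/2`, `r = ‖1 - c‖`, and `V` within `1/200` of the ideal conjugator
`V₀ = R W R⁻¹`. Then `r²/2 ≤ ‖1 - [c, V c V⁻¹]‖ ≤ 2 r²`. [cite: DawsonNielsen2006, §4.1 and Lemma 1] -/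
theorem chord_gcomm_conj_bounds {c R : SU2} {θ : ℝ} (hc : c = R * torus θ * R⁻¹) (h0 : 0 ≤ θ) (hθ : θ ≤ Real.pi / 2)
    {V : SU2} (hV : ‖(V : M2) - ((R * rot45 * R⁻¹ : SU2) : M2)‖ ≤ 1 / 200) :
    ‖(1 : M2) - (c : M2)‖ ^ 2 / 2 ≤ ‖(1 : M2) - ((gcomm c (V * c * V⁻¹) : SU2) : M2)‖ ∧
      ‖(1 : M2) - ((gcomm c (V * c * V⁻¹) : SU2) : M2)‖ ≤ 2 * ‖(1 : M2) - (c : M2)‖ ^ 2 := by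
  set r : ℝ := ‖(1 : M2) - (c : M2)‖ with hr
  have hr0 : 0 ≤ r := norm_nonneg _
  -- `r ≤ θ`
  have hrθ : r ≤ θ := by
    rw [hr, hc, norm_one_sub_conj]
    have := norm_one_sub_torus_le θ; rwa [abs_of_nonneg h0] at this
  -- the ideal conjugate and commutator
  set V₀ : SU2 := R * rot45 * R⁻¹ with hV₀
  set Y₀ : SU2 := V₀ * c * V₀⁻¹ with hY₀
  set Y : SU2 := V * c * V⁻¹ with hY
  have hY₀' : Y₀ = R * (rot45 * torus θ * rot45⁻¹) * R⁻¹ := by rw [hY₀, hV₀, hc]; group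
  have hideal : gcomm c Y₀ = R * gcomm (torus θ) (rot45 * torus θ * rot45⁻¹) * R⁻¹ := by
    rw [hc, hY₀', ← conj_gcomm]
  have hlow0 : 8 / Real.pi ^ 2 * θ ^ 2 ≤ ‖(1 : M2) - ((gcomm c Y₀ : SU2) : M2)‖ := by
    rw [hideal, norm_one_sub_conj]; exact torusComm_lower h0 hθ
  -- sizes
  have hcY₀ : ‖(1 : M2) - (Y₀ : M2)‖ = r := by rw [hY₀, norm_one_sub_conj]
  have hcY : ‖(1 : M2) - (Y : M2)‖ = r := by rw [hY, norm_one_sub_conj]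
  have hYY₀ : ‖(Y : M2) - (Y₀ : M2)‖ ≤ 2 * r * (1 / 200) := by
    rw [hY, hY₀]
    exact (norm_conj_sub_conj_le c V V₀).trans (mul_le_mul_of_nonneg_left hV (by positivity))
  have hpert := norm_gcomm_sub_gcomm_le c Y Y₀ (le_of_eq rfl) hcY₀.le hYY₀
  -- upper bound
  have hup : ‖(1 : M2) - ((gcomm c Y : SU2) : M2)‖ ≤ 2 * r ^ 2 := by
    have := norm_one_sub_gcomm_le c Y
    rw [hcY] at this
    nlinarith
  refine ⟨?_, hup⟩
  -- lower bound: ideal `≥ (8/π²) θ² ≥ (8/π²) r²`, perturbation `≤ 0.17 r²`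
  have hπ : 8 / 10 ≤ 8 / Real.pi ^ 2 := by
    have h1 := Real.pi_lt_d2
    have h2 := Real.pi_pos
    rw [div_le_div_iff₀ (by norm_num) (by positivity)]
    nlinarith
  have hlow1 : 8 / 10 * r ^ 2 ≤ ‖(1 : M2) - ((gcomm c Y₀ : SU2) : M2)‖ := by
    have e1 : 8 / 10 * r ^ 2 ≤ 8 / Real.pi ^ 2 * θ ^ 2 :=
      mul_le_mul hπ (pow_le_pow_left₀ hr0 hrθ 2) (by positivity) (by positivity)
    exact e1.trans hlow0
  have htri : ‖(1 : M2) - ((gcomm c Y₀ : SU2) : M2)‖ ≤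
      ‖(1 : M2) - ((gcomm c Y : SU2) : M2)‖ + ‖((gcomm c Y : SU2) : M2) - ((gcomm c Y₀ : SU2) : M2)‖ :=
    norm_sub_le_norm_sub_add_norm_sub _ _ _
  nlinarith [hpert, hlow1, htri, sq_nonneg r]

/-- **The trace-minimising conjugator from a `1/200`-net squares the chord up to constants.** If
`Net` is a `1/200`-net of `SU(2)`, `c = R D(θ) R⁻¹` with `0 ≤ θ ≤ π/2`, `r = ‖1 - c‖`, and
`V⋆ ∈ Net` minimises `Re tr [c, V c V⁻¹]` over `V ∈ Net` (the machine's exact criterion), then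
`r²/2 ≤ ‖1 - [c, V⋆ c V⋆⁻¹]‖ ≤ 2 r²`. [cite: AharonovArad2011, §3.3] [cite: DawsonNielsen2006, §4.1] -/
theorem chord_gcomm_best {Net : List SU2} (hNet : ∀ A : SU2, ∃ V ∈ Net, ‖(A : M2) - (V : M2)‖ ≤ 1 / 200)
    {c R : SU2} {θ : ℝ} (hc : c = R * torus θ * R⁻¹) (h0 : 0 ≤ θ) (hθ : θ ≤ Real.pi / 2)
    {Vs : SU2} (hopt : ∀ V ∈ Net, (((gcomm c (Vs * c * Vs⁻¹) : SU2) : M2).trace).re ≤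
      (((gcomm c (V * c * V⁻¹) : SU2) : M2).trace).re) :
    ‖(1 : M2) - (c : M2)‖ ^ 2 / 2 ≤ ‖(1 : M2) - ((gcomm c (Vs * c * Vs⁻¹) : SU2) : M2)‖ ∧
      ‖(1 : M2) - ((gcomm c (Vs * c * Vs⁻¹) : SU2) : M2)‖ ≤ 2 * ‖(1 : M2) - (c : M2)‖ ^ 2 := by
  obtain ⟨V, hV, hVR⟩ := hNet (R * rot45 * R⁻¹)
  have hgood := chord_gcomm_conj_bounds hc h0 hθ (V := V) (by rw [norm_sub_rev]; exact hVR)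
  refine ⟨?_, ?_⟩
  · -- the minimiser has at least the chord of the good candidate
    have h1 := norm_one_sub_coe_sq (gcomm c (Vs * c * Vs⁻¹))
    have h2 := norm_one_sub_coe_sq (gcomm c (V * c * V⁻¹))
    have h3 := hopt V hV
    have hsq : ‖(1 : M2) - ((gcomm c (V * c * V⁻¹) : SU2) : M2)‖ ^ 2 ≤
        ‖(1 : M2) - ((gcomm c (Vs * c * Vs⁻¹) : SU2) : M2)‖ ^ 2 := by rw [h1, h2]; linarith
    have hle := (pow_le_pow_iff_left₀ (norm_nonneg _) (norm_nonneg _) two_ne_zero).1 hsq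
    exact hgood.1.trans hle
  · have := norm_one_sub_gcomm_le c (Vs * c * Vs⁻¹)
    rw [norm_one_sub_conj] at this
    nlinarith [norm_nonneg ((1 : M2) - (c : M2))]

end Literature.Computability.QuantumComplexity

end
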